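import Literature.Geometry.Riemannian.PinchingEstimatesImprovingFn
import Literature.Geometry.Riemannian.PinchingEstimatesImprovingSpectral
import Literature.Geometry.Riemannian.PinchingEstimatesImprovingScalar
import Literature.Geometry.Riemannian.PinchingEstimatesTwoSingular
import Literature.Geometry.Riemannian.PinchingEstimatesSingular
import HarnessLib

/-!
# Hamilton 1997, Thm. 2.1 (improving pinching) at the level of the curvature ODE — proved
(topic `Geometry/Riemannian`)

Part of the decomposition of `Literature.Geometry.Riemannian.hamilton_chenZhu_pinching`
(`PinchingEstimates.lean`). Hamilton 1997, §2.2, Thm. 2.1 (p. 13): "For any constants `Λ` and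
`Ω` as before we can find a constant `K` such that the inequality
`2b₃/√((a₁+a₂)(c₁+c₂)) ≤ 1 + K / max{ln √((a₁+a₂)(c₁+c₂)), 2}` is preserved by the Ricci
flow", with Lemma 2.2 (p. 16). PROVED here at the ODE level, in exactly the shape of the
hypothesis `h21` of `hamilton_chenZhu_pinching_of_ode₂` (`PinchingEstimatesCompactness.lean`):

* `hamilton1997_B21_ode` — for `0 < m, Λ, Ξ` there is `K₀` such that for all `K ≥ K₀`,
  `K ≥ 0`, the family `{ImprovedPinching p K}` is forward invariant under Hamilton's ODE relative
  to `{A, C symmetric} ∩ {a₁+a₂ ≥ m} ∩ {c₁+c₂ ≥ m} ∩ {(b₂+b₃)² ≤ Λ(a₁+a₂)(c₁+c₂)} ∩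
  {max ≤ Ξ(a₁+a₂), Ξ(c₁+c₂)} ∩ {tr A = tr C}` (only symmetry, positivity and the Cor. 1.5
  bounds are used; `K₀ = 4Ξ₁ + 7168 Ξ₁⁵`, `Ξ₁ = max{Ξ, 1}`).

Proof (Hamilton, pp. 13–16, in the tree's variational language): below the corner `x = e²`
the inequality is the linear bound `2b₃ ≤ (1 + K/2)x`, implied by `b₃ ≤ Ξ(a₁+a₂), Ξ(c₁+c₂)`
once `K ≥ 4Ξ`; the `C¹` branch `impFn K 2` (`PinchingEstimatesImprovingFn.lean`) of Hamilton's
function through the corner dominates it, so it suffices to run the smooth minimum principle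
`minOverSet_nonneg_of_deriv` (`HamiltonODEMinBarrier.lean`) for
`G = impFn K 2 (√((wᵀAw + w'ᵀAw')(zᵀCz + z'ᵀCz'))) - 2uᵀBv` over unit `u, v` and orthonormal
pairs `(w, w')`, `(z, z')`. At a minimiser with `G ≤ 0` one has `x ≥ e²`, the extremal vectors
decouple, and the exact derivative `G' = x·impFn'(x)·ℓ - 2b₃·μ` is controlled by the spectral
packages of `PinchingEstimatesImprovingSpectral.lean` and the real inequalities (Lemma 2.2,
bookkeeping) of `PinchingEstimatesImprovingScalar.lean`.

## References

* R. S. Hamilton, *Four-manifolds with positive isotropic curvature*, Comm. Anal. Geom. 5 (1997)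
  1–92, §2.2, Thm. 2.1 and Lemma 2.2 (pp. 13–16). [Hamilton1997]
* R. S. Hamilton, J. Differential Geom. 24 (1986), §3 (Lemmas 3.1, 3.5). [Hamilton1986]
-/

noncomputable section

open Set Real Filter
open scoped Matrix BigOperators Topology

namespace Literature.Geometry.Riemannian

namespace HamiltonODE

/-! ### The functional -/

/-- The parameter set: unit `u, v` and orthonormal pairs `(w, w')`, `(z, z')`,
`q = ((u, v), ((w, w'), (z, z')))`. [folklore] -/
def impSet : Set (UU × PP) := (unitSet ×ˢ unitSet) ×ˢ (pairSet ×ˢ pairSet)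

/-- It is compact. [folklore] -/
theorem isCompact_impSet : IsCompact impSet :=
  (isCompact_unitSet.prod isCompact_unitSet).prod (isCompact_pairSet.prod isCompact_pairSet)

/-- It is nonempty. [folklore] -/
theorem impSet_nonempty : impSet.Nonempty :=
  (unitSet_nonempty.prod unitSet_nonempty).prod (pairSet_nonempty.prod pairSet_nonempty)

/-- `X(q) = (wᵀAw + w'ᵀAw')(zᵀCz + z'ᵀCz')` (`= (a₁+a₂)(c₁+c₂)` at the minimising pairs). [folklore] -/
def impX (p : Blocks) (q : UU × PP) : ℝ := pairSumQ p.1 q.2.1 * pairSumQ p.2.2 q.2.2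

/-- Hamilton's Thm. 2.1 functional on the `C¹` branch: `G = impFn K 2 (√X) - 2uᵀBv`.
[cite: Hamilton1997, §2.2, Thm. 2.1 (p. 13)] -/
def impG (K : ℝ) (p : Blocks) (q : UU × PP) : ℝ :=
  impFn K 2 (sqrt (impX p q)) - 2 * (q.1.1 ⬝ᵥ (p.2.1 *ᵥ q.1.2))

/-- Its time derivative along a curve of blocks with velocity `p'`. [folklore] -/
def impG' (K : ℝ) (p p' : Blocks) (q : UU × PP) : ℝ :=
  impFnDeriv K 2 (sqrt (impX p q)) *
      ((pairSumQ p'.1 q.2.1 * pairSumQ p.2.2 q.2.2 + pairSumQ p.1 q.2.1 * pairSumQ p'.2.2 q.2.2) /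
        (2 * sqrt (impX p q))) -
    2 * (q.1.1 ⬝ᵥ (p'.2.1 *ᵥ q.1.2))

/-- The constant of Thm. 2.1 (explicit): `K₀ = 4Ξ₁ + 7168 Ξ₁⁵`, `Ξ₁ = max{Ξ, 1}`. [folklore] -/
def impK₀ (Ξ : ℝ) : ℝ := 4 * max Ξ 1 + 7168 * max Ξ 1 ^ 5

variable {K : ℝ} {p : Blocks}

/-- `ImprovedPinching` implies `G ≥ 0` on the parameter set (the branch dominates Hamilton's
function), when `X > 0` there. [folklore] -/
theorem impG_nonneg_of_improvedPinching (hK : 0 ≤ K) (hpos : ∀ q ∈ impSet, 0 < impX p q)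
    (h : ImprovedPinching p K) {q : UU × PP} (hq : q ∈ impSet) : 0 ≤ impG K p q := by
  obtain ⟨⟨u, v⟩, ⟨w, w'⟩, ⟨z, z'⟩⟩ := q
  obtain ⟨⟨hu, hv⟩, ⟨hw, hw', hww'⟩, ⟨hz, hz', hzz'⟩⟩ := hq
  have hX := hpos _ ⟨⟨hu, hv⟩, ⟨hw, hw', hww'⟩, ⟨hz, hz', hzz'⟩⟩
  have h1 := h u v w w' z z' hu hv hw hw' hww' hz hz' hzz'
  have h2 := hamiltonFn_le_impFn (Q := 2) (K := K) (by norm_num) hK (Real.sqrt_pos.2 hX)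
  simp only [impG, impX, pairSumQ] at h2 hX ⊢
  linarith

/-- Conversely, `G ≥ 0` on the parameter set together with the linear bound
`2uᵀBv ≤ (1 + K/2)√X` (which the previous estimates supply) gives `ImprovedPinching`.
[cite: Hamilton1997, §2.2, Thm. 2.1 (proof, p. 14)] -/
theorem improvedPinching_of_impG_nonneg (hpos : ∀ q ∈ impSet, 0 < impX p q)
    (hlin : ∀ q ∈ impSet, 2 * (q.1.1 ⬝ᵥ (p.2.1 *ᵥ q.1.2)) ≤ (1 + K / 2) * sqrt (impX p q))
    (h : ∀ q ∈ impSet, 0 ≤ impG K p q) : ImprovedPinching p K := by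
  intro u v w w' z z' hu hv hw hw' hww' hz hz' hzz'
  have hq : (((u, v), ((w, w'), (z, z'))) : UU × PP) ∈ impSet :=
    ⟨⟨hu, hv⟩, ⟨hw, hw', hww'⟩, ⟨hz, hz', hzz'⟩⟩
  have hX := hpos _ hq
  have hG := h _ hq
  have hl := hlin _ hq
  simp only [impG, impX, pairSumQ] at hG hX hl ⊢
  set x := sqrt ((w ⬝ᵥ (p.1 *ᵥ w) + w' ⬝ᵥ (p.1 *ᵥ w')) * (z ⬝ᵥ (p.2.2 *ᵥ z) + z' ⬝ᵥ (p.2.2 *ᵥ z')))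
    with hx
  have hx0 : 0 < x := Real.sqrt_pos.2 hX
  rcases le_or_gt (exp 2) x with hex | hlt
  · rw [← impFn_eq_hamiltonFn hex]; linarith
  · rw [hamiltonFn_of_lt hx0 hlt]; exact hl

/-- **The linear bound from Cor. 1.5**: `b₃ ≤ Ξ(a₁+a₂)` and `≤ Ξ(c₁+c₂)` give `uᵀBv ≤ Ξ √X` on the
parameter set (`a₁+a₂, c₁+c₂ > 0`). [cite: Hamilton1997, §2.2, Thm. 2.1 (proof, p. 14)] -/
theorem bilin_le_sqrt_impX {Ξ m : ℝ} (hΞ : 0 ≤ Ξ) (hm : 0 < m) (h12A : p.1.TwoSmallestEigenvaluesSumGE m)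
    (h12C : p.2.2.TwoSmallestEigenvaluesSumGE m) (hMX : MaxLEPairSum p Ξ) {q : UU × PP}
    (hq : q ∈ impSet) : q.1.1 ⬝ᵥ (p.2.1 *ᵥ q.1.2) ≤ Ξ * sqrt (impX p q) := by
  obtain ⟨⟨u, v⟩, ⟨w, w'⟩, ⟨z, z'⟩⟩ := q
  obtain ⟨⟨hu, hv⟩, ⟨hw, hw', hww'⟩, ⟨hz, hz', hzz'⟩⟩ := hq
  have hα : m ≤ pairSumQ p.1 (w, w') := h12A w w' hw hw' hww'
  have hγ : m ≤ pairSumQ p.2.2 (z, z') := h12C z z' hz hz' hzz'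
  have h1 : u ⬝ᵥ (p.2.1 *ᵥ v) ≤ Ξ * pairSumQ p.1 (w, w') := (hMX u v w w' hu hv hw hw' hww').1.2.1
  have h2 : u ⬝ᵥ (p.2.1 *ᵥ v) ≤ Ξ * pairSumQ p.2.2 (z, z') := (hMX u v z z' hu hv hz hz' hzz').2.2.1
  simp only [impX]
  set Y := u ⬝ᵥ (p.2.1 *ᵥ v)
  have hXs : 0 ≤ Ξ * sqrt (pairSumQ p.1 (w, w') * pairSumQ p.2.2 (z, z')) := by positivity
  rcases le_or_gt Y 0 with hY | hY
  · exact hY.trans hXs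
  · have hsq : Y ^ 2 ≤ (Ξ * sqrt (pairSumQ p.1 (w, w') * pairSumQ p.2.2 (z, z'))) ^ 2 := by
      rw [mul_pow, Real.sq_sqrt (by nlinarith)]
      nlinarith [mul_le_mul h1 h2 hY.le (by nlinarith)]
    exact le_of_sq_le_sq hsq hXs

/-! ### Calculus -/

/-- Derivative of `X` along a differentiable curve of blocks. [folklore] -/
theorem hasDerivAt_impX {γ : ℝ → Blocks} {γ' : Blocks} {s : ℝ} (hγ : HasDerivAt γ γ' s) (q : UU × PP) :
    _root_.HasDerivAt (fun t ↦ impX (γ t) q)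
      (pairSumQ γ'.1 q.2.1 * pairSumQ (γ s).2.2 q.2.2 + pairSumQ (γ s).1 q.2.1 * pairSumQ γ'.2.2 q.2.2) s := by
  have h := (hasDerivAt_pairSumQ hγ.1 q.2.1).mul (hasDerivAt_pairSumQ hγ.2.2 q.2.2)
  show _root_.HasDerivAt ((fun t ↦ pairSumQ (γ t).1 q.2.1) * fun t ↦ pairSumQ (γ t).2.2 q.2.2) _ s
  exact h

/-- Derivative of `G` along a differentiable curve of blocks (where `X > 0`). [folklore] -/
theorem hasDerivAt_impG (K : ℝ) {γ : ℝ → Blocks} {γ' : Blocks} {s : ℝ} (hγ : HasDerivAt γ γ' s)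
    (q : UU × PP) (hpos : 0 < impX (γ s) q) :
    _root_.HasDerivAt (fun t ↦ impG K (γ t) q) (impG' K (γ s) γ' q) s := by
  have hX := hasDerivAt_impX hγ q
  have hsx := hX.sqrt hpos.ne'
  have hx0 : 0 < sqrt (impX (γ s) q) := Real.sqrt_pos.2 hpos
  have hf := (hasDerivAt_impFn (K := K) (Q := 2) (by norm_num) hx0).comp s hsx
  have hY : _root_.HasDerivAt (fun t ↦ q.1.1 ⬝ᵥ ((γ t).2.1 *ᵥ q.1.2)) (q.1.1 ⬝ᵥ (γ'.2.1 *ᵥ q.1.2)) s :=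
    hasDerivAt_quadForm hγ.2.1 _ _
  have h := hf.sub (hY.const_mul 2)
  refine h.congr_deriv ?_
  simp only [impG']

/-- `(p, q) ↦ X` is continuous. [folklore] -/
theorem continuous_impX : Continuous fun z : Blocks × (UU × PP) ↦ impX z.1 z.2 := by
  unfold impX
  have hX := continuous_pairSumQ'
  exact (hX.comp ((continuous_fst.comp continuous_fst).prodMk
      (continuous_fst.comp (continuous_snd.comp continuous_snd)))).mul
    (hX.comp ((continuous_snd.comp (continuous_snd.comp continuous_fst)).prodMk
      (continuous_snd.comp (continuous_snd.comp continuous_snd))))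

/-- `(p, q) ↦ G` is continuous where `X > 0`. [folklore] -/
theorem continuousOn_impG (K : ℝ) :
    ContinuousOn (fun z : Blocks × (UU × PP) ↦ impG K z.1 z.2) {z | 0 < impX z.1 z.2} := by
  unfold impG
  have hsx : Continuous fun z : Blocks × (UU × PP) ↦ sqrt (impX z.1 z.2) :=
    continuous_sqrt.comp continuous_impX
  have hf : ContinuousOn (fun z : Blocks × (UU × PP) ↦ impFn K 2 (sqrt (impX z.1 z.2)))
      {z | 0 < impX z.1 z.2} :=
    (continuousOn_impFn (Q := 2) (by norm_num) K).comp hsx.continuousOn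
      fun z hz ↦ Real.sqrt_pos.2 hz
  have hY : Continuous fun z : Blocks × (UU × PP) ↦ z.2.1.1 ⬝ᵥ (z.1.2.1 *ᵥ z.2.1.2) :=
    continuous_quadForm.comp ((continuous_fst.comp (continuous_snd.comp continuous_fst)).prodMk
      ((continuous_fst.comp (continuous_fst.comp continuous_snd)).prodMk
        (continuous_snd.comp (continuous_fst.comp continuous_snd))))
  exact hf.sub (continuous_const.mul hY).continuousOn

/-- `(p, p', q) ↦ G'` is continuous where `X > 0`. [folklore] -/
theorem continuousOn_impG' (K : ℝ) :
    ContinuousOn (fun z : Blocks × Blocks × (UU × PP) ↦ impG' K z.1 z.2.1 z.2.2)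
      {z | 0 < impX z.1 z.2.2} := by
  unfold impG'
  have hX := continuous_pairSumQ'
  have hp : Continuous fun z : Blocks × Blocks × (UU × PP) ↦ z.1 := continuous_fst
  have hp' : Continuous fun z : Blocks × Blocks × (UU × PP) ↦ z.2.1 := continuous_fst.comp continuous_snd
  have hq : Continuous fun z : Blocks × Blocks × (UU × PP) ↦ z.2.2 := continuous_snd.comp continuous_snd
  have hXz : Continuous fun z : Blocks × Blocks × (UU × PP) ↦ impX z.1 z.2.2 :=
    continuous_impX.comp (hp.prodMk hq)
  have hsx : Continuous fun z : Blocks × Blocks × (UU × PP) ↦ sqrt (impX z.1 z.2.2) :=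
    continuous_sqrt.comp hXz
  have hf : ContinuousOn (fun z : Blocks × Blocks × (UU × PP) ↦ impFnDeriv K 2 (sqrt (impX z.1 z.2.2)))
      {z | 0 < impX z.1 z.2.2} :=
    (continuousOn_impFnDeriv (Q := 2) (by norm_num) K).comp hsx.continuousOn
      fun z hz ↦ Real.sqrt_pos.2 hz
  have hW := continuous_fst.comp (continuous_snd.comp hq)
  have hZ := continuous_snd.comp (continuous_snd.comp hq)
  have hnum : Continuous fun z : Blocks × Blocks × (UU × PP) ↦
      pairSumQ z.2.1.1 z.2.2.2.1 * pairSumQ z.1.2.2 z.2.2.2.2 +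
        pairSumQ z.1.1 z.2.2.2.1 * pairSumQ z.2.1.2.2 z.2.2.2.2 :=
    ((hX.comp ((continuous_fst.comp hp').prodMk hW)).mul
      (hX.comp ((continuous_snd.comp (continuous_snd.comp hp)).prodMk hZ))).add
    ((hX.comp ((continuous_fst.comp hp).prodMk hW)).mul
      (hX.comp ((continuous_snd.comp (continuous_snd.comp hp')).prodMk hZ)))
  have hquot : ContinuousOn (fun z : Blocks × Blocks × (UU × PP) ↦
      (pairSumQ z.2.1.1 z.2.2.2.1 * pairSumQ z.1.2.2 z.2.2.2.2 +
        pairSumQ z.1.1 z.2.2.2.1 * pairSumQ z.2.1.2.2 z.2.2.2.2) / (2 * sqrt (impX z.1 z.2.2)))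
      {z | 0 < impX z.1 z.2.2} :=
    hnum.continuousOn.div (continuous_const.mul hsx).continuousOn
      fun z hz ↦ mul_ne_zero two_ne_zero (Real.sqrt_pos.2 hz).ne'
  have hY' : Continuous fun z : Blocks × Blocks × (UU × PP) ↦ z.2.2.1.1 ⬝ᵥ (z.2.1.2.1 *ᵥ z.2.2.1.2) :=
    continuous_quadForm.comp ((continuous_fst.comp (continuous_snd.comp hp')).prodMk
      ((continuous_fst.comp (continuous_fst.comp hq)).prodMk (continuous_snd.comp (continuous_fst.comp hq))))
  exact (hf.mul hquot).sub (continuous_const.mul hY').continuousOn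

attribute [local irreducible] impG in
/-- Joint continuity of `G` along a continuous curve of blocks with `X > 0`. [folklore] -/
theorem continuousOn_impG_family (K : ℝ) {γ : ℝ → Blocks} {S : Set ℝ} (hγ : ContinuousOn γ S)
    (hpos : ∀ s ∈ S, ∀ q ∈ impSet, 0 < impX (γ s) q) :
    ContinuousOn (fun z : ℝ × (UU × PP) ↦ impG K (γ z.1) z.2) (S ×ˢ impSet) := by
  have h1 : ContinuousOn (fun z : ℝ × (UU × PP) ↦ γ z.1) (S ×ˢ impSet) :=
    hγ.comp continuousOn_fst fun z hz ↦ (Set.mem_prod.1 hz).1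
  refine (continuousOn_impG K).comp (h1.prodMk continuousOn_snd) fun z hz ↦ ?_
  obtain ⟨hs, hq⟩ := Set.mem_prod.1 hz
  exact hpos z.1 hs z.2 hq

attribute [local irreducible] impG' in
/-- Joint continuity of `G'` along a continuous solution with `X > 0`. [folklore] -/
theorem continuousOn_impG'_family (K : ℝ) {γ : ℝ → Blocks} {S : Set ℝ} (hγ : ContinuousOn γ S)
    (hpos : ∀ s ∈ S, ∀ q ∈ impSet, 0 < impX (γ s) q) :
    ContinuousOn (fun z : ℝ × (UU × PP) ↦ impG' K (γ z.1) (field (γ z.1)) z.2) (S ×ˢ impSet) := by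
  have h1 : ContinuousOn (fun z : ℝ × (UU × PP) ↦ γ z.1) (S ×ˢ impSet) :=
    hγ.comp continuousOn_fst fun z hz ↦ (Set.mem_prod.1 hz).1
  refine (continuousOn_impG' K).comp
    (h1.prodMk ((continuous_field.comp_continuousOn h1).prodMk continuousOn_snd)) fun z hz ↦ ?_
  obtain ⟨hs, hq⟩ := Set.mem_prod.1 hz
  exact hpos z.1 hs z.2 hq

/-! ### The sign condition at a minimiser -/

/-- Decoupling of the pair-sum minimisation through the strictly increasing branch: if
`impFn K 2 (√(α' γ)) - c ≥ impFn K 2 (√(α γ)) - c` with `α, α', γ > 0` then `α ≤ α'`. [folklore] -/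
theorem le_of_impFn_sqrt_le (hK : 0 ≤ K) {α α' γ : ℝ} (hα : 0 < α) (hα' : 0 < α') (hγ : 0 < γ)
    (h : impFn K 2 (sqrt (α * γ)) ≤ impFn K 2 (sqrt (α' * γ))) : α ≤ α' := by
  have hmono := impFn_strictMonoOn (K := K) (Q := 2) (by norm_num) hK
  have h1 : sqrt (α * γ) ≤ sqrt (α' * γ) :=
    (hmono.le_iff_le (Real.sqrt_pos.2 (mul_pos hα hγ)) (Real.sqrt_pos.2 (mul_pos hα' hγ))).1 h
  have h2 := (Real.sqrt_le_sqrt_iff (mul_pos hα' hγ).le).1 h1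
  exact le_of_mul_le_mul_right h2 hγ

/-- **The sign condition at a minimiser of `G`** (pointwise form of Hamilton's Thm. 2.1 with
Lemma 2.2): with the constraint data at one time, `K ≥ K₀(Ξ)` and `R ≥ Σ|A| + Σ|B| + Σ|C|`, if
`G ≤ 0` at a minimiser then `4R · G ≤ G'`. [cite: Hamilton1997, §2.2, Thm. 2.1 and Lemma 2.2 (pp. 13–16)] -/
theorem improving_sign {Ξ m R : ℝ} (hm : 0 < m) (hΞ : 0 < Ξ) (hK : impK₀ Ξ ≤ K) {p : Blocks}
    (hA : p.1.IsSymm) (hC : p.2.2.IsSymm) (h12A : p.1.TwoSmallestEigenvaluesSumGE m)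
    (h12C : p.2.2.TwoSmallestEigenvaluesSumGE m) (hMX : MaxLEPairSum p Ξ)
    (hR : (∑ k, ∑ l, |p.1 k l|) + (∑ k, ∑ l, |p.2.1 k l|) + ∑ k, ∑ l, |p.2.2 k l| ≤ R)
    {q : UU × PP} (hq : q ∈ impSet) (hqmin : IsMinOn (impG K p) impSet q) (hG0 : impG K p q ≤ 0) :
    4 * R * impG K p q ≤ impG' K p (field p) q := by
  obtain ⟨⟨u, v⟩, ⟨w, w'⟩, ⟨z, z'⟩⟩ := q
  obtain ⟨⟨hu, hv⟩, ⟨hw, hw', hww'⟩, ⟨hz, hz', hzz'⟩⟩ := hq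
  obtain ⟨A, B, C⟩ := p
  simp only at hA hC h12A h12C hMX hR hqmin hG0 ⊢
  dsimp only at hu hv hw hw' hww' hz hz' hzz'
  replace hu : u ⬝ᵥ u = 1 := hu
  replace hv : v ⬝ᵥ v = 1 := hv
  -- constants
  have hΞ₁ : 1 ≤ max Ξ 1 := le_max_right _ _
  have hΞle : Ξ ≤ max Ξ 1 := le_max_left _ _
  have hK4 : 4 * Ξ ≤ K := by
    have : (0 : ℝ) ≤ 7168 * max Ξ 1 ^ 5 := by positivity
    simp only [impK₀] at hK; linarith only [hK, this, hΞle]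
  have hK7 : 14 * max Ξ 1 ^ 3 * (512 * max Ξ 1 ^ 2) ≤ K := by
    have : (0 : ℝ) ≤ 4 * max Ξ 1 := by positivity
    simp only [impK₀] at hK; nlinarith only [hK, this]
  have hKpos : 0 < K := by linarith only [hK4, hΞ]
  -- positivity of the pair sums and `x = √X`
  set α := pairSumQ A (w, w') with hαdef
  set γ := pairSumQ C (z, z') with hγdef
  have hαm : m ≤ α := h12A w w' hw hw' hww'
  have hγm : m ≤ γ := h12C z z' hz hz' hzz'
  have hα : 0 < α := hm.trans_le hαm
  have hγ : 0 < γ := hm.trans_le hγm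
  have hXpos : 0 < α * γ := mul_pos hα hγ
  set x := sqrt (α * γ) with hxdef
  have hx : 0 < x := Real.sqrt_pos.2 hXpos
  have hx2 : x ^ 2 = α * γ := Real.sq_sqrt hXpos.le
  set Y := u ⬝ᵥ (B *ᵥ v) with hYdef
  -- the linear bound and `x ≥ e²`
  have hYΞ : Y ≤ Ξ * x := by
    have := bilin_le_sqrt_impX (p := (A, B, C)) hΞ.le hm h12A h12C hMX
      (q := ((u, v), ((w, w'), (z, z')))) ⟨⟨hu, hv⟩, ⟨hw, hw', hww'⟩, ⟨hz, hz', hzz'⟩⟩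
    simpa [impX] using this
  have hGval : impG K (A, B, C) ((u, v), ((w, w'), (z, z'))) = impFn K 2 x - 2 * Y := by
    simp [impG, impX, hxdef, hαdef, hγdef, hYdef]
  have hG0' : impFn K 2 x - 2 * Y ≤ 0 := by rw [← hGval]; exact hG0
  have hex : exp 2 ≤ x := by
    refine exp_le_of_impFn_le (K := K) (by norm_num) hKpos hx ?_
    have : 2 * Y ≤ (1 + K / 2) * x := by nlinarith only [hYΞ, hK4, hx]
    linarith only [this, hG0']
  have hL : 2 ≤ log x := by
    have := Real.log_le_log (exp_pos 2) hex
    rwa [Real.log_exp] at this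
  set L := log x with hLdef
  have hfx : impFn K 2 x = (1 + K / L) * x := impFn_of_le hex
  have hfx' : impFnDeriv K 2 x = 1 + K / L - K / L ^ 2 := impFnDeriv_of_le hex hx
  have hKL : 0 ≤ K / L := div_nonneg hKpos.le (by linarith)
  have hxY : x ≤ 2 * Y := by rw [hfx] at hG0'; nlinarith only [hG0', hKL, hx]
  have hYpos : 0 < Y := by linarith only [hxY, hx]
  -- decoupling: `(u, v)` maximises `uᵀBv`, `(w, w')` and `(z, z')` minimise the pair sums
  have hmaxB : ∀ u' v' : Fin 3 → ℝ, u' ⬝ᵥ u' = 1 → v' ⬝ᵥ v' = 1 → u' ⬝ᵥ (B *ᵥ v') ≤ Y := by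
    intro u' v' hu' hv'
    have h := hqmin (show ((u', v'), ((w, w'), (z, z'))) ∈ impSet from
      ⟨⟨hu', hv'⟩, ⟨hw, hw', hww'⟩, ⟨hz, hz', hzz'⟩⟩)
    simp only [mem_setOf_eq, impG, impX] at h
    linarith only [h, hYdef]
  have hminW : ∀ r ∈ pairSet, α ≤ pairSumQ A r := by
    intro r hr
    have h := hqmin (show ((u, v), (r, (z, z'))) ∈ impSet from ⟨⟨hu, hv⟩, hr, ⟨hz, hz', hzz'⟩⟩)
    simp only [mem_setOf_eq, impG, impX] at h
    have hαr : 0 < pairSumQ A r := hm.trans_le (h12A r.1 r.2 hr.1 hr.2.1 hr.2.2)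
    exact le_of_impFn_sqrt_le hKpos.le hα hαr hγ (by linarith only [h, hαdef, hγdef])
  have hminZ : ∀ r ∈ pairSet, γ ≤ pairSumQ C r := by
    intro r hr
    have h := hqmin (show ((u, v), ((w, w'), r)) ∈ impSet from ⟨⟨hu, hv⟩, ⟨hw, hw', hww'⟩, hr⟩)
    simp only [mem_setOf_eq, impG, impX] at h
    have hγr : 0 < pairSumQ C r := hm.trans_le (h12C r.1 r.2 hr.1 hr.2.1 hr.2.2)
    refine le_of_impFn_sqrt_le hKpos.le hγ hγr hα ?_
    rw [mul_comm γ α, mul_comm (pairSumQ C r) α]; linarith only [h, hαdef, hγdef]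
  -- the spectral packages
  obtain ⟨a₁, a₂, a₃, nA, hnA, hαeq, ha₁₂, ha₂₃, hAbd, hnAeq, hPA'⟩ :=
    planeMin_package (B := B) hA hw hw' hww' hminW
  obtain ⟨c₁, c₂, c₃, nC, hnC, hγeq, hc₁₂, hc₂₃, hCbd, hnCeq, hPC'⟩ :=
    planeMin_package (A := C) (B := Bᵀ) hC hz hz' hzz' hminZ
  rw [Matrix.transpose_transpose, Matrix.trace_mul_comm] at hPC'
  obtain ⟨hYB', β, hβ, hF1, hF2, hdet⟩ := singularMax_package (A := A) (C := C) hu hv hmaxB hYpos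
  set F := (B * Bᵀ).trace with hFdef
  -- bounds feeding Lemma 2.2
  have hnAY : (Bᵀ *ᵥ nA) ⬝ᵥ (Bᵀ *ᵥ nA) ≤ Y ^ 2 :=
    normSq_mulTranspose_le_sq_of_bound hYpos.le fun v' hv' ↦ hmaxB nA v' hnA hv'
  have hnCY : (B *ᵥ nC) ⬝ᵥ (B *ᵥ nC) ≤ Y ^ 2 := by
    have h := normSq_mulTranspose_le_sq_of_bound (N := Bᵀ) (u := nC) hYpos.le fun v' hv' ↦ by
      rw [Matrix.dotProduct_transpose_mulVec] -- `nCᵀ Bᵀ v' = v'ᵀ B nC`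
      exact hmaxB v' nC hv' hnC
    rwa [Matrix.transpose_transpose] at h
  have hnA0 : 0 ≤ (Bᵀ *ᵥ nA) ⬝ᵥ (Bᵀ *ᵥ nA) := Finset.sum_nonneg fun i _ ↦ mul_self_nonneg _
  have hnC0 : 0 ≤ (B *ᵥ nC) ⬝ᵥ (B *ᵥ nC) := Finset.sum_nonneg fun i _ ↦ mul_self_nonneg _
  have huA : u ⬝ᵥ (A *ᵥ u) ≤ a₃ := (hAbd u hu).2
  have hvC : v ⬝ᵥ (C *ᵥ v) ≤ c₃ := (hCbd v hv).2
  have hα2 : 0 < a₁ + a₂ := by rw [← hαeq]; exact hα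
  have hγ2 : 0 < c₁ + c₂ := by rw [← hγeq]; exact hγ
  have hx2' : x ^ 2 = (a₁ + a₂) * (c₁ + c₂) := by rw [← hαeq, ← hγeq]; exact hx2
  have ha₃α : a₃ ≤ Ξ * (a₁ + a₂) := by
    rw [← hnAeq, ← hαeq]; exact (hMX nA v w w' hnA hv hw hw' hww').1.1
  have ha₃γ : a₃ ≤ Ξ * (c₁ + c₂) := by
    rw [← hnAeq, ← hγeq]; exact (hMX nA v z z' hnA hv hz hz' hzz').2.1
  have hc₃α : c₃ ≤ Ξ * (a₁ + a₂) := by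
    rw [← hnCeq, ← hαeq]; exact (hMX nC v w w' hnC hv hw hw' hww').1.2.2
  have hc₃γ : c₃ ≤ Ξ * (c₁ + c₂) := by
    rw [← hnCeq, ← hγeq]; exact (hMX nC v z z' hnC hv hz hz' hzz').2.2.2
  have hYα : Y ≤ Ξ * (a₁ + a₂) := by rw [← hαeq]; exact (hMX u v w w' hu hv hw hw' hww').1.2.1
  have hYγ : Y ≤ Ξ * (c₁ + c₂) := by rw [← hγeq]; exact (hMX u v z z' hu hv hz hz' hzz').2.2.1
  -- Lemma 2.2 and `ℓ ≤ C x`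
  set SA := F - (Bᵀ *ᵥ nA) ⬝ᵥ (Bᵀ *ᵥ nA) with hSAdef
  set SC := F - (B *ᵥ nC) ⬝ᵥ (B *ᵥ nC) with hSCdef
  set ℓ := ((a₁ ^ 2 + a₂ ^ 2 + SA) / (a₁ + a₂) + (c₁ ^ 2 + c₂ ^ 2 + SC) / (c₁ + c₂)) / 2 + a₃ + c₃
    with hℓ
  set μ := u ⬝ᵥ (A *ᵥ u) + v ⬝ᵥ (C *ᵥ v) + 2 * B.det / Y ^ 2 with hμ
  obtain ⟨hμℓ, hδ⟩ := lemma22_lower ha₁₂ ha₂₃ hc₁₂ hc₂₃ hα2 hγ2 hx2' hx hYpos hβ hF1 hF2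
    (by rw [hSAdef]; linarith) (by rw [hSCdef]; linarith) huA hvC hdet hΞ ha₃γ hc₃α hYα hYγ hℓ hμ hxY
  have hℓx := ell_le ha₁₂ ha₂₃ hc₁₂ hc₂₃ hα2 hγ2 hx2' hx hYpos hF1 hF2 (by rw [hSAdef]; linarith)
    (by rw [hSCdef]; linarith) hΞ ha₃α ha₃γ hc₃α hc₃γ hYα hYγ hℓ
  -- `μ ≤ 4R`
  have hAnn : 0 ≤ ∑ k, ∑ l, |A k l| := Finset.sum_nonneg fun k _ ↦ Finset.sum_nonneg fun l _ ↦ abs_nonneg _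
  have hBnn : 0 ≤ ∑ k, ∑ l, |B k l| := Finset.sum_nonneg fun k _ ↦ Finset.sum_nonneg fun l _ ↦ abs_nonneg _
  have hCnn : 0 ≤ ∑ k, ∑ l, |C k l| := Finset.sum_nonneg fun k _ ↦ Finset.sum_nonneg fun l _ ↦ abs_nonneg _
  have hμR : μ ≤ 4 * R := by
    have h1 : u ⬝ᵥ (A *ᵥ u) ≤ R := by
      have := (abs_le.1 (abs_quad_le_sum A hu)).2; linarith only [this, hR, hBnn, hCnn]
    have h2 : v ⬝ᵥ (C *ᵥ v) ≤ R := by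
      have := (abs_le.1 (abs_quad_le_sum C hv)).2; linarith only [this, hR, hAnn, hBnn]
    have h3 : Y ≤ R := by
      have := (abs_le.1 (abs_bilin_le_sum B hu hv)).2; linarith only [this, hR, hAnn, hCnn, hYdef]
    have hβY : β ≤ Y := le_of_sq_le_sq (by linarith only [hF1, hF2]) hYpos.le
    have h4 : 2 * B.det / Y ^ 2 ≤ 2 * β := by
      rw [div_le_iff₀ (by positivity)]
      have : |B.det| ≤ β * Y ^ 2 := hdet.trans (by nlinarith only [hF2, hβ])
      linarith only [this, le_abs_self B.det]
    rw [hμ]; linarith only [h1, h2, h3, h4, hβY]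
  -- the bookkeeping
  have key := improving_bookkeeping hμℓ hδ hℓx (by positivity) (by positivity) hx hL hK7
    (G := impFn K 2 x - 2 * Y) (by rw [hfx]) hG0' hμR
  -- identify `G'`
  have hG'val : impG' K (A, B, C) (field (A, B, C)) ((u, v), ((w, w'), (z, z'))) =
      (1 + K / L - K / L ^ 2) * x * ℓ - 2 * Y * μ := by
    have e1 : impG' K (A, B, C) (field (A, B, C)) ((u, v), ((w, w'), (z, z'))) =
        impFnDeriv K 2 x * ((pairSumQ (A * A + B * Bᵀ + (2 : ℝ) • A.sharp) (w, w') * pairSumQ C (z, z') +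
          pairSumQ A (w, w') * pairSumQ (C * C + Bᵀ * B + (2 : ℝ) • C.sharp) (z, z')) / (2 * x)) -
          2 * (u ⬝ᵥ ((A * B + B * C + (2 : ℝ) • B.sharp) *ᵥ v)) := by
      simp [impG', impX, field, hxdef, hαdef, hγdef]
    rw [← hYdef] at hYB'
    rw [e1, hfx', hPA', hPC', hYB']
    have ePA : pairSumQ A (w, w') = a₁ + a₂ := hαeq
    have ePC : pairSumQ C (z, z') = c₁ + c₂ := hγeq
    rw [ePA, ePC]
    have hα0 : a₁ + a₂ ≠ 0 := hα2.ne'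
    have hγ0 : c₁ + c₂ ≠ 0 := hγ2.ne'
    have hx0 : x ≠ 0 := hx.ne'
    have hY0 : Y ≠ 0 := hYpos.ne'
    have hqx : ∀ N : ℝ, N / (2 * x) = x * N / (2 * ((a₁ + a₂) * (c₁ + c₂))) := by
      intro N
      rw [← hx2']
      field_simp
    rw [hqx, hℓ, hμ, hSAdef, hSCdef]
    field_simp
    ring
  rw [hGval, hG'val]
  exact key

/-! ### Thm. 2.1, ODE part -/

/-- **Hamilton 1997, Thm. 2.1 with Lemma 2.2, ODE part (proved)** — exactly the hypothesis `h21`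
of `hamilton_chenZhu_pinching_of_ode₂` (`PinchingEstimatesCompactness.lean`): for `0 < m, Λ, Ξ`
there is `K₀` (`= impK₀ Ξ`) such that for every `K ≥ K₀`, `K ≥ 0`, the family
`{2b₃ ≤ (1 + K/max{ln √((a₁+a₂)(c₁+c₂)), 2}) √((a₁+a₂)(c₁+c₂))}` is forward invariant under
Hamilton's ODE relative to the previous estimates. [cite: Hamilton1997, §2.2, Thm. 2.1 (pp. 13–16)] -/
theorem hamilton1997_B21_ode : ∀ m Λ Ξ : ℝ, 0 < m → 0 < Λ → 0 < Ξ → ∃ K₀ : ℝ, ∀ K : ℝ, K₀ ≤ K → 0 ≤ K →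
    IsInvariantRel field
      (fun _ ↦ {p : Blocks | (p.1.IsSymm ∧ p.2.2.IsSymm) ∧ p.1.TwoSmallestEigenvaluesSumGE m ∧
        p.2.2.TwoSmallestEigenvaluesSumGE m ∧ SingularValuesSumSqLE p Λ ∧
        MaxLEPairSum p Ξ ∧ p.1.trace = p.2.2.trace})
      (fun _ ↦ {p | ImprovedPinching p K}) := by
  intro m Λ Ξ hm _ hΞ
  refine ⟨impK₀ Ξ, fun K hK hK0 γ t₀ t₁ _ h₁ hγ hKc hin ↦ ?_⟩
  have hγc := IsSolutionOn.continuousOn hγ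
  have hpos : ∀ s ∈ Icc t₀ t₁, ∀ q ∈ impSet, 0 < impX (γ s) q := by
    intro s hs q hq
    obtain ⟨-, h12A, h12C, -⟩ := hKc s hs
    exact mul_pos (hm.trans_le (h12A _ _ hq.2.1.1 hq.2.1.2.1 hq.2.1.2.2))
      (hm.trans_le (h12C _ _ hq.2.2.1 hq.2.2.2.1 hq.2.2.2.2))
  have hGc := continuousOn_impG_family K hγc hpos
  have hG'c := continuousOn_impG'_family K hγc hpos
  have hGd : ∀ q ∈ impSet, ∀ s ∈ Icc t₀ t₁, _root_.HasDerivAt (fun t ↦ impG K (γ t) q)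
      (impG' K (γ s) (field (γ s)) q) s := fun q hq s hs ↦ hasDerivAt_impG K (hγ s hs) q (hpos s hs q hq)
  -- uniform bound `R`
  have hent : ∀ {f : Blocks → Matrix (Fin 3) (Fin 3) ℝ}, Continuous f →
      ContinuousOn (fun t ↦ ∑ k, ∑ l, |f (γ t) k l|) (Icc t₀ t₁) := by
    intro f hf
    have h : ContinuousOn (fun t ↦ f (γ t)) (Icc t₀ t₁) := hf.comp_continuousOn hγc
    exact continuousOn_finsetSum _ fun k _ ↦ continuousOn_finsetSum _ fun l _ ↦
      ((continuousOn_pi.1 (continuousOn_pi.1 h k) l)).abs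
  have hScont : ContinuousOn (fun t ↦ (∑ k, ∑ l, |(γ t).1 k l|) + (∑ k, ∑ l, |(γ t).2.1 k l|) +
      ∑ k, ∑ l, |(γ t).2.2 k l|) (Icc t₀ t₁) :=
    ((hent (f := fun p ↦ p.1) continuous_fst).add
      (hent (f := fun p ↦ p.2.1) (continuous_fst.comp continuous_snd))).add
      (hent (f := fun p ↦ p.2.2) (continuous_snd.comp continuous_snd))
  obtain ⟨sR, -, hR⟩ := isCompact_Icc.exists_isMaxOn (nonempty_Icc.2 h₁) hScont
  set R := (∑ k, ∑ l, |(γ sR).1 k l|) + (∑ k, ∑ l, |(γ sR).2.1 k l|) + ∑ k, ∑ l, |(γ sR).2.2 k l|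
    with hRdef
  have hR' : ∀ s ∈ Icc t₀ t₁, (∑ k, ∑ l, |(γ s).1 k l|) + (∑ k, ∑ l, |(γ s).2.1 k l|) +
      ∑ k, ∑ l, |(γ s).2.2 k l| ≤ R := fun s hs ↦ hR hs
  have hC0 : 0 ≤ 4 * R := by positivity
  have key := minOverSet_nonneg_of_deriv (G := fun t q ↦ impG K (γ t) q)
    (G' := fun t q ↦ impG' K (γ t) (field (γ t)) q) isCompact_impSet impSet_nonempty
    hGc hGd hG'c h₁ one_pos hC0 (η := 1) (fun s hs q hq hqmin _ hG0 ↦ ?_) ?_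
  · -- at `t₁`: `G ≥ 0` and the linear bound give `ImprovedPinching`
    obtain ⟨-, h12A, h12C, -, hMX, -⟩ := hKc t₁ (right_mem_Icc.2 h₁)
    have hall := (le_minOverSet_iff isCompact_impSet impSet_nonempty (continuousOn_slice
      (G := fun t q ↦ impG K (γ t) q) hGc (right_mem_Icc.2 h₁)) 0).1 key
    refine improvedPinching_of_impG_nonneg (hpos t₁ (right_mem_Icc.2 h₁)) (fun q hq ↦ ?_) hall
    have h1 := bilin_le_sqrt_impX hΞ.le hm h12A h12C hMX hq
    have hK4 : 4 * Ξ ≤ K := by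
      have : (0 : ℝ) ≤ 7168 * max Ξ 1 ^ 5 := by positivity
      have hΞle : Ξ ≤ max Ξ 1 := le_max_left _ _
      simp only [impK₀] at hK; nlinarith
    have hs0 : 0 ≤ sqrt (impX (γ t₁) q) := Real.sqrt_nonneg _
    nlinarith [mul_le_mul_of_nonneg_right hK4 hs0]
  · have hsI : s ∈ Icc t₀ t₁ := Ico_subset_Icc_self hs
    obtain ⟨⟨hA, hC⟩, h12A, h12C, -, hMX, -⟩ := hKc s hsI
    exact improving_sign hm hΞ hK hA hC h12A h12C hMX (hR' s hsI) hq hqmin hG0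
  · refine (le_minOverSet_iff isCompact_impSet impSet_nonempty (continuousOn_slice
      (G := fun t q ↦ impG K (γ t) q) hGc (left_mem_Icc.2 h₁)) 0).2 fun q hq ↦ ?_
    exact impG_nonneg_of_improvedPinching hK0 (hpos t₀ (left_mem_Icc.2 h₁)) hin hq

end HamiltonODE

end Literature.Geometry.Riemannian

end
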